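import Literature.Analysis.Calculus.PlanarRotation
import Literature.Analysis.Calculus.AngularMomentumFields
import Literature.Analysis.Calculus.SphereIntegralCalculus
import HarnessLib

/-!
# A finite-dimensional spectral shell for the spherical Laplacian

Analysis support file (everything proved; three small definitions with bodies, no named facts)
towards the sharp Poincaré / eigenvalue inequalities on round spheres needed in A. Waldron,
*Long-time existence for Yang–Mills flow*, Invent. math. 217 (2019), Lemma 3.5 and §4
("the first eigenvalue of the Hodge Laplacian on closed 2-forms on `S³` is 4, on functions 3"),
done WITHOUT functional analysis: the spherical Laplacian `T = ½∑ᵢ∑ⱼ ∂_{L_{ij}}²`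
(`AngularMomentumFields`) is symmetric on `C²` functions for the sphere measure (integration by
parts along the divergence-free rotation fields, `PlanarRotation`), so for any finite
`L²(S_r)`-orthonormal family of `T`-eigenfunctions `e₁,…,e_M` whose eigenvalue-`0` members are
constant and whose other eigenvalues are `≥ Λ`, the Dirichlet form of every `C²` function `f`
splits off its projection `πf = ∑ₖ ⟨f,eₖ⟩ eₖ`:

* `angDeriv`, `sphLaplacian`, `sphDirichlet` — `∂_{L_{ij}}f`, `T f`, and
  `Q_r(f,g) = ½∑ᵢ∑ⱼ ∮_{S_r} ∂_{L_{ij}}f ∂_{L_{ij}}g`;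
* `sphereIntegral_angDeriv_mul_angDeriv` — `∮ ∂_L f ∂_L g = −∮ f ∂_L∂_L g`, whence
  `sphDirichlet_eq_neg_sphereIntegral` — `Q_r(f,g) = −∮ f · T g` (symmetry of `T`);
* `sphDirichlet_ge_of_eigenfamily` — **the shell estimate**
  `Q_r(f,f) ≥ Λ (∮ f² − ∮ (f − πf)² − (∮ f)²/∮ 1)`.
Fed with the restrictions of harmonic polynomials (eigenvalues `k(k+n−2)`) and Stone–Weierstrass
density this yields the sharp Poincaré inequality `Q₁(f,f) ≥ (n−1) ∮(f − f̄)²` on `S^{n−1}`.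

References: A. Waldron, Invent. math. 217 (2019), Lemma 3.5 [Waldron2019]; (spherical harmonics)
[folklore].
-/

noncomputable section

open MeasureTheory Set Metric Filter
open scoped Topology RealInnerProductSpace
open Literature.Analysis.FluidPDE

namespace Literature.Analysis.Calculus

section Calculus

variable {E : Type*} [NormedAddCommGroup E] [InnerProductSpace ℝ E]
variable {ι : Type*} [Fintype ι]

/-! ### The objects (pointwise) -/

/-- The derivative along the angular field: `∂_{L_{ij}} f (x) = Df(x)(L_{ij}x)`. [folklore] -/
def angDeriv (b : OrthonormalBasis ι ℝ E) (i j : ι) (f : E → ℝ) (x : E) : ℝ :=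
  fderiv ℝ f x (angularField b i j x)

/-- The spherical Laplacian (times `r²` on `S_r`): `T f = ½∑ᵢ∑ⱼ ∂_{L_{ij}}∂_{L_{ij}} f`.
[folklore] -/
def sphLaplacian (b : OrthonormalBasis ι ℝ E) (f : E → ℝ) (x : E) : ℝ :=
  (1 / 2) * ∑ i, ∑ j, angDeriv b i j (angDeriv b i j f) x

/-- Unfolding lemma. [folklore] -/
theorem angDeriv_apply (b : OrthonormalBasis ι ℝ E) (i j : ι) (f : E → ℝ) (x : E) :
    angDeriv b i j f x = fderiv ℝ f x (angularField b i j x) := rfl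

/-- `∂_{L_{ij}} f` is `C^m` off the origin if `f` is `C^{n}` there, `m + 1 ≤ n`. [folklore] -/
theorem contDiffOn_angDeriv (b : OrthonormalBasis ι ℝ E) (i j : ι) {f : E → ℝ} {m n : WithTop ℕ∞}
    (hf : ContDiffOn ℝ n f {0}ᶜ) (hmn : m + 1 ≤ n) : ContDiffOn ℝ m (angDeriv b i j f) {0}ᶜ := by
  unfold angDeriv
  have hD : ContDiffOn ℝ m (fderiv ℝ f) {0}ᶜ := hf.fderiv_of_isOpen isOpen_compl_singleton hmn
  have hL : ContDiff ℝ m (angularField b i j) := by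
    have h : angularField b i j =
        fun y => ((innerSL ℝ (b i)).smulRight (b j) - (innerSL ℝ (b j)).smulRight (b i)) y :=
      funext fun y => angularField_eq_clm b i j y
    rw [h]; exact ContinuousLinearMap.contDiff _
  exact hD.clm_apply hL.contDiffOn

/-- `∂_{L_{ij}} f` is continuous off the origin for `f ∈ C¹`. [folklore] -/
theorem continuousOn_angDeriv (b : OrthonormalBasis ι ℝ E) (i j : ι) {f : E → ℝ} {n : WithTop ℕ∞}
    (hf : ContDiffOn ℝ n f {0}ᶜ) (hn : 1 ≤ n) : ContinuousOn (angDeriv b i j f) {0}ᶜ :=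
  (contDiffOn_angDeriv b i j (m := 0) hf (by simpa using hn)).continuousOn

/-- `T f` is continuous off the origin for `f ∈ C²`. [folklore] -/
theorem continuousOn_sphLaplacian (b : OrthonormalBasis ι ℝ E) {f : E → ℝ}
    (hf : ContDiffOn ℝ 2 f {0}ᶜ) : ContinuousOn (sphLaplacian b f) {0}ᶜ := by
  unfold sphLaplacian
  refine continuousOn_const.mul (continuousOn_finsetSum _ fun i _ =>
    continuousOn_finsetSum _ fun j _ => ?_)
  exact continuousOn_angDeriv b i j (contDiffOn_angDeriv b i j (m := 1) hf (by norm_num)) le_rfl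

/-- Product rule for the angular derivative at a point. [folklore] -/
theorem angDeriv_mul (b : OrthonormalBasis ι ℝ E) (i j : ι) {f g : E → ℝ} {x : E}
    (hf : DifferentiableAt ℝ f x) (hg : DifferentiableAt ℝ g x) :
    angDeriv b i j (fun y => f y * g y) x = angDeriv b i j f x * g x + f x * angDeriv b i j g x := by
  have h : HasFDerivAt (fun y => f y * g y) (f x • fderiv ℝ g x + g x • fderiv ℝ f x) x :=
    hf.hasFDerivAt.mul hg.hasFDerivAt
  simp only [angDeriv, h.fderiv, FunLike.coe_add, Pi.add_apply, FunLike.coe_smul, Pi.smul_apply,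
    smul_eq_mul]
  ring

/-- Linearity of the angular derivative in the function (finite linear combinations), at a point
where all the functions are differentiable. [folklore] -/
theorem angDeriv_sum_mul (b : OrthonormalBasis ι ℝ E) (i j : ι) {κ : Type*} (s : Finset κ)
    (c : κ → ℝ) {e : κ → E → ℝ} {x : E} (he : ∀ k ∈ s, DifferentiableAt ℝ (e k) x) :
    angDeriv b i j (fun y => ∑ k ∈ s, c k * e k y) x = ∑ k ∈ s, c k * angDeriv b i j (e k) x := by
  simp only [angDeriv]
  have h : (fun y => ∑ k ∈ s, c k * e k y) = ∑ k ∈ s, fun y => c k * e k y := by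
    funext y; simp [Finset.sum_apply]
  rw [h, fderiv_sum fun k hk => (he k hk).const_mul (c k)]
  simp only [FunLike.coe_sum, Finset.sum_apply]
  refine Finset.sum_congr rfl fun k hk => ?_
  rw [fderiv_const_mul (he k hk)]
  simp

/-- The angular derivative of a difference. [folklore] -/
theorem angDeriv_sub (b : OrthonormalBasis ι ℝ E) (i j : ι) {f g : E → ℝ} {x : E}
    (hf : DifferentiableAt ℝ f x) (hg : DifferentiableAt ℝ g x) :
    angDeriv b i j (fun y => f y - g y) x = angDeriv b i j f x - angDeriv b i j g x := by
  have h : HasFDerivAt (fun y => f y - g y) (fderiv ℝ f x - fderiv ℝ g x) x :=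
    hf.hasFDerivAt.sub hg.hasFDerivAt
  simp only [angDeriv, h.fderiv, FunLike.coe_sub, Pi.sub_apply]

end Calculus

section Sphere

variable {E : Type*} [NormedAddCommGroup E] [InnerProductSpace ℝ E] [FiniteDimensional ℝ E]
  [MeasurableSpace E] [BorelSpace E]
variable {ι : Type*} [Fintype ι]

/-- The spherical Dirichlet form at radius `r`:
`Q_r(f,g) = ½∑ᵢ∑ⱼ ∮_{S_r} ∂_{L_{ij}}f ∂_{L_{ij}}g` (sphere integral for Lebesgue measure).
[folklore] -/
def sphDirichlet (b : OrthonormalBasis ι ℝ E) (f g : E → ℝ) (r : ℝ) : ℝ :=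
  (1 / 2) * ∑ i, ∑ j, sphereIntegral (volume : Measure E)
    (fun x => angDeriv b i j f x * angDeriv b i j g x) r

/-- `Q_r` is symmetric. [folklore] -/
theorem sphDirichlet_comm (b : OrthonormalBasis ι ℝ E) (f g : E → ℝ) (r : ℝ) :
    sphDirichlet b f g r = sphDirichlet b g f r := by
  simp only [sphDirichlet, mul_comm (angDeriv b _ _ f _)]

/-! ### Sphere-integral bookkeeping -/

/-- Sphere integrals only see the values on the sphere. [folklore] -/
theorem sphereIntegral_congr_norm {f g : E → ℝ} {r : ℝ} (hr : 0 ≤ r)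
    (h : ∀ x, ‖x‖ = r → f x = g x) :
    sphereIntegral (volume : Measure E) f r = sphereIntegral (volume : Measure E) g r := by
  rw [sphereIntegral_def, sphereIntegral_def]
  exact integral_congr_ae (ae_of_all _ fun θ => h _ (norm_smul_sphere hr θ))

/-- `sphereIntegral` of a difference of integrands continuous off the origin. [folklore] -/
theorem sphereIntegral_sub' {f g : E → ℝ} (hf : ContinuousOn f {0}ᶜ) (hg : ContinuousOn g {0}ᶜ)
    {r : ℝ} (hr : 0 < r) :
    sphereIntegral (volume : Measure E) (fun x => f x - g x) r =
      sphereIntegral (volume : Measure E) f r - sphereIntegral (volume : Measure E) g r := by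
  simp only [sphereIntegral_def]
  exact integral_sub (integrable_toSphere_of_continuousOn hf hr)
    (integrable_toSphere_of_continuousOn hg hr)

/-- `sphereIntegral_add` with the summands given explicitly (keeps integrands in `fun` form).
[folklore] -/
theorem sphereIntegral_add_of (f g : E → ℝ) (hf : ContinuousOn f {0}ᶜ) (hg : ContinuousOn g {0}ᶜ)
    {r : ℝ} (hr : 0 < r) :
    sphereIntegral (volume : Measure E) (fun x => f x + g x) r =
      sphereIntegral (volume : Measure E) f r + sphereIntegral (volume : Measure E) g r :=
  sphereIntegral_add hf hg hr

/-- `sphereIntegral_sub'` with the integrands given explicitly. [folklore] -/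
theorem sphereIntegral_sub_of (f g : E → ℝ) (hf : ContinuousOn f {0}ᶜ) (hg : ContinuousOn g {0}ᶜ)
    {r : ℝ} (hr : 0 < r) :
    sphereIntegral (volume : Measure E) (fun x => f x - g x) r =
      sphereIntegral (volume : Measure E) f r - sphereIntegral (volume : Measure E) g r :=
  sphereIntegral_sub' hf hg hr

/-- `sphereIntegral_finset_sum` with the integrands given explicitly. [folklore] -/
theorem sphereIntegral_sum_of {κ : Type*} (t : Finset κ) (F : κ → E → ℝ)
    (hF : ∀ k ∈ t, ContinuousOn (F k) {0}ᶜ) {r : ℝ} (hr : 0 < r) :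
    sphereIntegral (volume : Measure E) (fun x => ∑ k ∈ t, F k x) r =
      ∑ k ∈ t, sphereIntegral (volume : Measure E) (F k) r :=
  sphereIntegral_finset_sum t hF hr

/-- Constants come out of `sphereIntegral`. [folklore] -/
theorem sphereIntegral_mul_left (c : ℝ) (f : E → ℝ) (r : ℝ) :
    sphereIntegral (volume : Measure E) (fun x => c * f x) r =
      c * sphereIntegral (volume : Measure E) f r := by
  simp only [sphereIntegral_def]
  exact integral_const_mul c _

/-- `sphereIntegral` of a nonnegative function is nonnegative. [folklore] -/
theorem sphereIntegral_nonneg' {f : E → ℝ} (hf : ∀ x, 0 ≤ f x) (r : ℝ) :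
    0 ≤ sphereIntegral (volume : Measure E) f r := by
  rw [sphereIntegral_def]; exact integral_nonneg fun θ => hf _

omit [InnerProductSpace ℝ E] [FiniteDimensional ℝ E] [MeasurableSpace E] [BorelSpace E] in
/-- A point of positive norm is not the origin. [folklore] -/
theorem mem_compl_zero_of_norm_eq {x : E} {r : ℝ} (hr : 0 < r) (hx : ‖x‖ = r) :
    x ∈ ({0}ᶜ : Set E) := by
  intro h; rw [show x = 0 from h, norm_zero] at hx; exact hr.ne' hx.symm

/-! ### Symmetry of the spherical Laplacian -/

/-- **Integration by parts along the rotation fields**: for `f ∈ C¹`, `g ∈ C²` off the origin and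
`r > 0`, `∮_{S_r} ∂_{L_{ij}}f ∂_{L_{ij}}g = −∮_{S_r} f ∂_{L_{ij}}∂_{L_{ij}}g`. [folklore] -/
theorem sphereIntegral_angDeriv_mul_angDeriv [Nontrivial E] (b : OrthonormalBasis ι ℝ E) (i j : ι)
    {f g : E → ℝ} (hf : ContDiffOn ℝ 1 f {0}ᶜ) (hg : ContDiffOn ℝ 2 g {0}ᶜ) {r : ℝ} (hr : 0 < r) :
    sphereIntegral (volume : Measure E) (fun x => angDeriv b i j f x * angDeriv b i j g x) r =
      -sphereIntegral (volume : Measure E)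
        (fun x => f x * angDeriv b i j (angDeriv b i j g) x) r := by
  have hO : IsOpen ({0}ᶜ : Set E) := isOpen_compl_singleton
  have hG : ContDiffOn ℝ 1 (angDeriv b i j g) {0}ᶜ := contDiffOn_angDeriv b i j (m := 1) hg
    (by norm_num)
  have hg1 : ContDiffOn ℝ 1 g {0}ᶜ := hg.of_le (by norm_num)
  -- the product `f · ∂_L g` is `C¹` off the origin and its angular derivative integrates to zero
  have hq : ContDiffOn ℝ 1 (fun y => f y * angDeriv b i j g y) {0}ᶜ := hf.mul hG
  by_cases hij : i = j
  · -- `L_{ii} = 0`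
    subst hij
    have hL : ∀ x : E, angularField b i i x = 0 := fun x => by simp [angularField]
    have h1 : ∀ x, angDeriv b i i f x * angDeriv b i i g x = 0 := fun x => by
      simp [angDeriv, hL]
    have h2 : ∀ x, f x * angDeriv b i i (angDeriv b i i g) x = 0 := fun x => by
      simp [angDeriv, hL]
    simp only [h1, h2]
    simp [sphereIntegral_def]
  · have horth : ⟪b i, b j⟫ = 0 := b.orthonormal.2 hij
    have h0 := sphereIntegral_fderiv_angular_eq_zero (E := E) (b.orthonormal.1 i)
      (b.orthonormal.1 j) horth hq hr
    -- expand the angular derivative of the product on the sphere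
    have hexp : ∀ x, ‖x‖ = r →
        fderiv ℝ (fun y => f y * angDeriv b i j g y) x (⟪x, b i⟫ • b j - ⟪x, b j⟫ • b i) =
          angDeriv b i j f x * angDeriv b i j g x + f x * angDeriv b i j (angDeriv b i j g) x := by
      intro x hx
      have hx0 : x ∈ ({0}ᶜ : Set E) := mem_compl_zero_of_norm_eq hr hx
      have hfd : DifferentiableAt ℝ f x :=
        (hf.differentiableOn one_ne_zero).differentiableAt (hO.mem_nhds hx0)
      have hGd : DifferentiableAt ℝ (angDeriv b i j g) x :=
        (hG.differentiableOn one_ne_zero).differentiableAt (hO.mem_nhds hx0)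
      rw [← angularField_apply, ← angDeriv_apply, angDeriv_mul b i j hfd hGd]
    rw [sphereIntegral_congr_norm hr.le hexp] at h0
    have hc1 : ContinuousOn (fun x => angDeriv b i j f x * angDeriv b i j g x) {0}ᶜ :=
      (continuousOn_angDeriv b i j hf le_rfl).mul (continuousOn_angDeriv b i j hg1 le_rfl)
    have hc2 : ContinuousOn (fun x => f x * angDeriv b i j (angDeriv b i j g) x) {0}ᶜ :=
      hf.continuousOn.mul (continuousOn_angDeriv b i j hG le_rfl)
    rw [sphereIntegral_add hc1 hc2 hr] at h0
    linarith

/-- **Symmetry of the spherical Laplacian**: `Q_r(f,g) = −∮_{S_r} f · T g` for `f ∈ C¹`, `g ∈ C²`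
off the origin, `r > 0`. [folklore] -/
theorem sphDirichlet_eq_neg_sphereIntegral [Nontrivial E] (b : OrthonormalBasis ι ℝ E)
    {f g : E → ℝ} (hf : ContDiffOn ℝ 1 f {0}ᶜ) (hg : ContDiffOn ℝ 2 g {0}ᶜ) {r : ℝ} (hr : 0 < r) :
    sphDirichlet b f g r =
      -sphereIntegral (volume : Measure E) (fun x => f x * sphLaplacian b g x) r := by
  unfold sphDirichlet sphLaplacian
  simp_rw [sphereIntegral_angDeriv_mul_angDeriv b _ _ hf hg hr]
  have hcont : ∀ i j, ContinuousOn (fun x => f x * angDeriv b i j (angDeriv b i j g) x) {0}ᶜ :=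
    fun i j => hf.continuousOn.mul (continuousOn_angDeriv b i j
      (contDiffOn_angDeriv b i j (m := 1) hg (by norm_num)) le_rfl)
  have hfun : (fun x => f x * (1 / 2 * ∑ i, ∑ j, angDeriv b i j (angDeriv b i j g) x)) =
      fun x => 1 / 2 * ∑ i, ∑ j, f x * angDeriv b i j (angDeriv b i j g) x := by
    funext x
    rw [mul_left_comm, Finset.mul_sum]
    congr 1
    exact Finset.sum_congr rfl fun i _ => Finset.mul_sum _ _ _
  rw [hfun, sphereIntegral_mul_left, sphereIntegral_finset_sum _ (fun i _ =>
      continuousOn_finsetSum _ fun j _ => hcont i j) hr]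
  simp_rw [sphereIntegral_finset_sum _ (fun j _ => hcont _ j) hr]
  simp only [Finset.sum_neg_distrib, mul_neg]

/-! ### Algebra of finite orthonormal families on the sphere -/

/-- The total mass `σ_r := ∮_{S_r} 1` of the sphere measure is positive. [folklore] -/
theorem sphereIntegral_one_pos [Nontrivial E] (r : ℝ) :
    0 < sphereIntegral (volume : Measure E) (fun _ => (1 : ℝ)) r := by
  rw [sphereIntegral_def, integral_const, smul_eq_mul, mul_one]
  haveI : NeZero (volume : Measure E).toSphere := ⟨Measure.toSphere_ne_zero _⟩
  exact measureReal_univ_pos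

/-- The sphere integral of a function constant on the sphere. [folklore] -/
theorem sphereIntegral_of_eq_const {f : E → ℝ} {r a : ℝ} (hr : 0 ≤ r)
    (h : ∀ x, ‖x‖ = r → f x = a) :
    sphereIntegral (volume : Measure E) f r =
      a * sphereIntegral (volume : Measure E) (fun _ => (1 : ℝ)) r := by
  rw [sphereIntegral_congr_norm hr h, ← sphereIntegral_mul_left]; simp

/-- `∮ (∑ₖ uₖ eₖ)(∑ₗ vₗ eₗ) = ∑ₖ uₖ vₖ` for an `L²(S_r)`-orthonormal family. [folklore] -/
theorem sphereIntegral_sum_mul_sum {M : ℕ} {e : Fin M → E → ℝ} (he : ∀ k, ContinuousOn (e k) {0}ᶜ)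
    {r : ℝ} (hr : 0 < r)
    (hon : ∀ k l, sphereIntegral (volume : Measure E) (fun x => e k x * e l x) r =
      if k = l then 1 else 0)
    (u v : Fin M → ℝ) :
    sphereIntegral (volume : Measure E) (fun x => (∑ k, u k * e k x) * (∑ l, v l * e l x)) r =
      ∑ k, u k * v k := by
  have hfun : (fun x => (∑ k, u k * e k x) * (∑ l, v l * e l x)) =
      fun x => ∑ k, ∑ l, (u k * v l) * (e k x * e l x) := by
    funext x
    rw [Finset.sum_mul_sum]
    exact Finset.sum_congr rfl fun k _ => Finset.sum_congr rfl fun l _ => by ring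
  have hcont : ∀ k l, ContinuousOn (fun x => (u k * v l) * (e k x * e l x)) {0}ᶜ := fun k l =>
    continuousOn_const.mul ((he k).mul (he l))
  rw [hfun, sphereIntegral_sum_of Finset.univ (fun k x => ∑ l, (u k * v l) * (e k x * e l x))
    (fun k _ => continuousOn_finsetSum _ fun l _ => hcont k l) hr]
  refine Finset.sum_congr rfl fun k _ => ?_
  rw [sphereIntegral_sum_of Finset.univ (fun l x => (u k * v l) * (e k x * e l x))
    (fun l _ => hcont k l) hr]
  simp_rw [sphereIntegral_mul_left, hon, mul_ite, mul_one, mul_zero, Finset.sum_ite_eq,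
    Finset.mem_univ, if_true]

/-- `∮ g · (∑ₖ uₖ eₖ) = ∑ₖ uₖ ∮ g eₖ`. [folklore] -/
theorem sphereIntegral_mul_sum {M : ℕ} {e : Fin M → E → ℝ} (he : ∀ k, ContinuousOn (e k) {0}ᶜ)
    {g : E → ℝ} (hg : ContinuousOn g {0}ᶜ) {r : ℝ} (hr : 0 < r) (u : Fin M → ℝ) :
    sphereIntegral (volume : Measure E) (fun x => g x * ∑ k, u k * e k x) r =
      ∑ k, u k * sphereIntegral (volume : Measure E) (fun x => g x * e k x) r := by
  have hfun : (fun x => g x * ∑ k, u k * e k x) = fun x => ∑ k, u k * (g x * e k x) := by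
    funext x; rw [Finset.mul_sum]; exact Finset.sum_congr rfl fun k _ => by ring
  rw [hfun, sphereIntegral_sum_of Finset.univ (fun k x => u k * (g x * e k x))
    (fun k _ => continuousOn_const.mul (hg.mul (he k))) hr]
  simp_rw [sphereIntegral_mul_left]

omit [FiniteDimensional ℝ E] [MeasurableSpace E] [BorelSpace E] in
/-- Linearity of the spherical Laplacian on finite linear combinations, off the origin. [folklore] -/
theorem sphLaplacian_sum_mul (b : OrthonormalBasis ι ℝ E) {M : ℕ} (c : Fin M → ℝ)
    {e : Fin M → E → ℝ} (he : ∀ k, ContDiffOn ℝ 2 (e k) {0}ᶜ) {x : E} (hx : x ∈ ({0}ᶜ : Set E)) :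
    sphLaplacian b (fun y => ∑ k, c k * e k y) x = ∑ k, c k * sphLaplacian b (e k) x := by
  have hO : IsOpen ({0}ᶜ : Set E) := isOpen_compl_singleton
  unfold sphLaplacian
  -- reduce to the termwise identity
  have key : ∀ F : ι → ι → Fin M → ℝ, (1 / 2 : ℝ) * ∑ i, ∑ j, ∑ k, c k * F i j k =
      ∑ k, c k * ((1 / 2 : ℝ) * ∑ i, ∑ j, F i j k) := by
    intro F
    have h1 : ∀ k, c k * ((1 / 2 : ℝ) * ∑ i, ∑ j, F i j k) =
        (1 / 2 : ℝ) * ∑ i, ∑ j, c k * F i j k := by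
      intro k
      rw [mul_left_comm, Finset.mul_sum]
      congr 1
      exact Finset.sum_congr rfl fun i _ => Finset.mul_sum _ _ _
    simp_rw [h1]
    rw [← Finset.mul_sum]
    congr 1
    calc ∑ i, ∑ j, ∑ k, c k * F i j k = ∑ i, ∑ k, ∑ j, c k * F i j k :=
          Finset.sum_congr rfl fun i _ => Finset.sum_comm
      _ = ∑ k, ∑ i, ∑ j, c k * F i j k := Finset.sum_comm
  suffices h : ∀ i j, angDeriv b i j (angDeriv b i j fun y => ∑ k, c k * e k y) x =
      ∑ k, c k * angDeriv b i j (angDeriv b i j (e k)) x by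
    simp_rw [h]
    exact key _
  intro i j
  -- the inner angular derivative, on the open set `{0}ᶜ`
  have h1 : ∀ y ∈ ({0}ᶜ : Set E), angDeriv b i j (fun z => ∑ k, c k * e k z) y =
      ∑ k, c k * angDeriv b i j (e k) y := fun y hy =>
    angDeriv_sum_mul b i j _ c fun k _ =>
      ((he k).differentiableOn two_ne_zero).differentiableAt (hO.mem_nhds hy)
  have h2 : angDeriv b i j (angDeriv b i j fun z => ∑ k, c k * e k z) x =
      angDeriv b i j (fun y => ∑ k, c k * angDeriv b i j (e k) y) x := by
    simp only [angDeriv]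
    congr 1
    exact Filter.EventuallyEq.fderiv_eq (Filter.eventuallyEq_of_mem (hO.mem_nhds hx) h1)
  rw [h2]
  exact angDeriv_sum_mul b i j _ c fun k _ =>
    ((contDiffOn_angDeriv b i j (m := 1) (he k) (by norm_num)).differentiableOn
      one_ne_zero).differentiableAt (hO.mem_nhds hx)

/-! ### The shell estimate -/

/-- **The finite-dimensional spectral shell estimate.** Let `e₁,…,e_M` be `C²` off the origin,
`L²(S_r)`-orthonormal, eigenfunctions of the spherical Laplacian on `S_r`
(`T eₖ = −λₖ eₖ` on `S_r`) such that `λₖ = 0` forces `eₖ` to be constant on `S_r` and otherwise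
`λₖ ≥ Λ ≥ 0`. Then for every `f ∈ C²` off the origin, with `πf = ∑ₖ (∮ f eₖ) eₖ`,
`Q_r(f,f) ≥ Λ (∮ f² − ∮ (f − πf)² − (∮ f)²/∮ 1)`
(`Q_r(f,f) = Q_r(πf,πf) + Q_r(f−πf, f−πf)` since `T` is symmetric and preserves `span eₖ`).
[folklore] -/
theorem sphDirichlet_ge_of_eigenfamily [Nontrivial E] (b : OrthonormalBasis ι ℝ E) {r : ℝ}
    (hr : 0 < r) {M : ℕ} {e : Fin M → E → ℝ} (he : ∀ k, ContDiffOn ℝ 2 (e k) {0}ᶜ)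
    (hon : ∀ k l, sphereIntegral (volume : Measure E) (fun x => e k x * e l x) r =
      if k = l then 1 else 0)
    {lam : Fin M → ℝ} (heig : ∀ k x, ‖x‖ = r → sphLaplacian b (e k) x = -lam k * e k x)
    {Λ : ℝ} (hΛ : 0 ≤ Λ) (hgap : ∀ k, lam k = 0 ∨ Λ ≤ lam k)
    (hconst : ∀ k, lam k = 0 → ∀ x y, ‖x‖ = r → ‖y‖ = r → e k x = e k y)
    {f : E → ℝ} (hf : ContDiffOn ℝ 2 f {0}ᶜ) :
    Λ * (sphereIntegral (volume : Measure E) (fun x => f x ^ 2) r -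
        sphereIntegral (volume : Measure E)
          (fun x => (f x - ∑ k, sphereIntegral (volume : Measure E) (fun y => f y * e k y) r * e k x) ^ 2) r -
        (sphereIntegral (volume : Measure E) f r) ^ 2 /
          sphereIntegral (volume : Measure E) (fun _ => (1 : ℝ)) r) ≤
      sphDirichlet b f f r := by
  have hO : IsOpen ({0}ᶜ : Set E) := isOpen_compl_singleton
  -- ### notation
  set c : Fin M → ℝ := fun k => sphereIntegral (volume : Measure E) (fun y => f y * e k y) r
    with hc
  set πf : E → ℝ := fun x => ∑ k, c k * e k x with hπf
  set g : E → ℝ := fun x => f x - πf x with hg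
  set σ : ℝ := sphereIntegral (volume : Measure E) (fun _ => (1 : ℝ)) r with hσ
  have hσpos : 0 < σ := sphereIntegral_one_pos r
  -- ### regularity
  have hec : ∀ k, ContinuousOn (e k) {0}ᶜ := fun k => (he k).continuousOn
  have hπ2 : ContDiffOn ℝ 2 πf {0}ᶜ := ContDiffOn.sum fun k _ => contDiffOn_const.mul (he k)
  have hg2 : ContDiffOn ℝ 2 g {0}ᶜ := hf.sub hπ2
  have hfc : ContinuousOn f {0}ᶜ := hf.continuousOn
  have hπc : ContinuousOn πf {0}ᶜ := hπ2.continuousOn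
  have hgc : ContinuousOn g {0}ᶜ := hg2.continuousOn
  have hfg : ∀ x, f x = πf x + g x := fun x => by simp [hg]
  -- ### (1) orthogonality of the remainder
  have horth : ∀ k, sphereIntegral (volume : Measure E) (fun x => g x * e k x) r = 0 := by
    intro k
    have h1 : (fun x => g x * e k x) = fun x => f x * e k x - πf x * e k x := by
      funext x; simp only [hg]; ring
    have h2 : sphereIntegral (volume : Measure E) (fun x => πf x * e k x) r = c k := by
      have h3 : (fun x => πf x * e k x) = fun x => e k x * ∑ l, c l * e l x := by
        funext x; simp only [hπf]; ring
      rw [h3, sphereIntegral_mul_sum hec (hec k) hr]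
      simp_rw [hon, mul_ite, mul_one, mul_zero]
      simp
    rw [h1, sphereIntegral_sub_of (fun x => f x * e k x) (fun x => πf x * e k x)
      (hfc.mul (hec k)) (hπc.mul (hec k)) hr, h2]
    simp [hc]
  -- ### (2) Pythagoras: `∑ cₖ² = ∮ f² − ∮ g²`
  have hππ : sphereIntegral (volume : Measure E) (fun x => πf x * πf x) r = ∑ k, c k * c k :=
    sphereIntegral_sum_mul_sum hec hr hon c c
  have hπg : sphereIntegral (volume : Measure E) (fun x => g x * πf x) r = 0 := by
    rw [show (fun x => g x * πf x) = fun x => g x * ∑ k, c k * e k x from rfl,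
      sphereIntegral_mul_sum hec hgc hr]
    simp [horth]
  have hpyth : ∑ k, c k ^ 2 = sphereIntegral (volume : Measure E) (fun x => f x ^ 2) r -
      sphereIntegral (volume : Measure E) (fun x => g x ^ 2) r := by
    have h1 : (fun x => f x ^ 2) = fun x => (πf x * πf x + 2 * (g x * πf x)) + g x ^ 2 := by
      funext x; rw [hfg x]; ring
    rw [h1, sphereIntegral_add_of (fun x => πf x * πf x + 2 * (g x * πf x)) (fun x => g x ^ 2)
      (((hπc.mul hπc).add (continuousOn_const.mul (hgc.mul hπc)))) (hgc.pow 2) hr,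
      sphereIntegral_add_of (fun x => πf x * πf x) (fun x => 2 * (g x * πf x)) (hπc.mul hπc)
      (continuousOn_const.mul (hgc.mul hπc)) hr, sphereIntegral_mul_left, hππ, hπg]
    simp [sq]
  -- ### (3) the Dirichlet form splits
  have hDf : ∀ i j, ∀ x, ‖x‖ = r →
      angDeriv b i j f x = angDeriv b i j πf x + angDeriv b i j g x := by
    intro i j x hx
    have hx0 := mem_compl_zero_of_norm_eq hr hx
    have hfd : DifferentiableAt ℝ f x := (hf.differentiableOn two_ne_zero).differentiableAt
      (hO.mem_nhds hx0)
    have hπd : DifferentiableAt ℝ πf x := (hπ2.differentiableOn two_ne_zero).differentiableAt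
      (hO.mem_nhds hx0)
    rw [show g = fun y => f y - πf y from rfl, angDeriv_sub b i j hfd hπd]; ring
  have hAπ : ∀ i j, ContinuousOn (angDeriv b i j πf) {0}ᶜ := fun i j =>
    continuousOn_angDeriv b i j hπ2 (by norm_num)
  have hAg : ∀ i j, ContinuousOn (angDeriv b i j g) {0}ᶜ := fun i j =>
    continuousOn_angDeriv b i j hg2 (by norm_num)
  have hsplit : sphDirichlet b f f r =
      sphDirichlet b πf πf r + 2 * sphDirichlet b g πf r + sphDirichlet b g g r := by
    unfold sphDirichlet
    rw [← mul_assoc, mul_comm (2 : ℝ), mul_assoc, ← mul_add, ← mul_add]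
    congr 1
    rw [Finset.mul_sum, ← Finset.sum_add_distrib, ← Finset.sum_add_distrib]
    refine Finset.sum_congr rfl fun i _ => ?_
    rw [Finset.mul_sum, ← Finset.sum_add_distrib, ← Finset.sum_add_distrib]
    refine Finset.sum_congr rfl fun j _ => ?_
    rw [sphereIntegral_congr_norm hr.le (fun x hx => show angDeriv b i j f x * angDeriv b i j f x =
        (angDeriv b i j πf x * angDeriv b i j πf x + 2 * (angDeriv b i j g x * angDeriv b i j πf x)) +
          angDeriv b i j g x * angDeriv b i j g x by rw [hDf i j x hx]; ring),
      sphereIntegral_add_of (fun x => angDeriv b i j πf x * angDeriv b i j πf x +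
        2 * (angDeriv b i j g x * angDeriv b i j πf x)) (fun x => angDeriv b i j g x * angDeriv b i j g x)
        (((hAπ i j).mul (hAπ i j)).add (continuousOn_const.mul ((hAg i j).mul (hAπ i j))))
        ((hAg i j).mul (hAg i j)) hr,
      sphereIntegral_add_of (fun x => angDeriv b i j πf x * angDeriv b i j πf x)
        (fun x => 2 * (angDeriv b i j g x * angDeriv b i j πf x)) ((hAπ i j).mul (hAπ i j))
        (continuousOn_const.mul ((hAg i j).mul (hAπ i j))) hr, sphereIntegral_mul_left]
  -- ### (4) the cross term vanishes and `Q(πf,πf) = ∑ λₖ cₖ²`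
  have hTπ : ∀ x, ‖x‖ = r → sphLaplacian b πf x = ∑ k, (-(lam k) * c k) * e k x := by
    intro x hx
    rw [show πf = fun y => ∑ k, c k * e k y from rfl,
      sphLaplacian_sum_mul b c he (mem_compl_zero_of_norm_eq hr hx)]
    exact Finset.sum_congr rfl fun k _ => by rw [heig k x hx]; ring
  have hcross : sphDirichlet b g πf r = 0 := by
    rw [sphDirichlet_eq_neg_sphereIntegral b (hg2.of_le (by norm_num)) hπ2 hr,
      sphereIntegral_congr_norm hr.le (fun x hx => show g x * sphLaplacian b πf x =
        g x * ∑ k, (-(lam k) * c k) * e k x by rw [hTπ x hx]),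
      sphereIntegral_mul_sum hec hgc hr]
    simp [horth]
  have hdiag : sphDirichlet b πf πf r = ∑ k, lam k * c k ^ 2 := by
    rw [sphDirichlet_eq_neg_sphereIntegral b (hπ2.of_le (by norm_num)) hπ2 hr,
      sphereIntegral_congr_norm hr.le (fun x hx => show πf x * sphLaplacian b πf x =
        (∑ k, c k * e k x) * ∑ k, (-(lam k) * c k) * e k x by rw [hTπ x hx]),
      sphereIntegral_sum_mul_sum hec hr hon]
    rw [← Finset.sum_neg_distrib]
    exact Finset.sum_congr rfl fun k _ => by ring
  -- ### (5) positivity of the remainder's form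
  have hpos : 0 ≤ sphDirichlet b g g r := by
    unfold sphDirichlet
    refine mul_nonneg (by norm_num) (Finset.sum_nonneg fun i _ => Finset.sum_nonneg fun j _ =>
      sphereIntegral_nonneg' (fun x => mul_self_nonneg _) r)
  -- ### (6) the zero modes: `∑_{λₖ=0} cₖ² ≤ (∮ f)²/σ`
  obtain ⟨x₀, hx₀⟩ := exists_norm_eq E hr.le
  set a : Fin M → ℝ := fun k => e k x₀ with ha
  set d : Fin M → ℝ := fun k => if lam k = 0 then a k else 0 with hd
  have hck : ∀ k, lam k = 0 → c k = a k * sphereIntegral (volume : Measure E) f r := by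
    intro k hk
    simp only [hc]
    rw [sphereIntegral_congr_norm hr.le (g := fun y => a k * f y) (fun y hy => by
      rw [hconst k hk y x₀ hy hx₀]; simp [ha, mul_comm]), sphereIntegral_mul_left]
  have hsZ : (∑ k, d k ^ 2) ≤ 1 / σ := by
    set sZ := ∑ k, d k ^ 2 with hsZdef
    -- the function `h = ∑ dₖ eₖ` is the constant `sZ` on the sphere
    have hh : ∀ y, ‖y‖ = r → (∑ k, d k * e k y) = sZ := by
      intro y hy
      simp only [hsZdef, hd]
      refine Finset.sum_congr rfl fun k _ => ?_
      split_ifs with hk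
      · rw [hconst k hk y x₀ hy hx₀]; simp [ha, sq]
      · simp
    have h1 : sphereIntegral (volume : Measure E) (fun y => (∑ k, d k * e k y) * ∑ k, d k * e k y) r
        = sZ := by
      rw [sphereIntegral_sum_mul_sum hec hr hon]; simp [hsZdef, sq]
    have h2 : sphereIntegral (volume : Measure E) (fun y => (∑ k, d k * e k y) * ∑ k, d k * e k y) r
        = sZ * sZ * σ := by
      rw [sphereIntegral_of_eq_const hr.le (a := sZ * sZ) (fun y hy => by rw [hh y hy])]
    have h3 : sZ * (sZ * σ - 1) = 0 := by nlinarith [h1.symm.trans h2]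
    rcases mul_eq_zero.1 h3 with h4 | h4
    · rw [h4]; positivity
    · rw [show sZ = 1 / σ by field_simp; linarith]
  have hZ : (∑ k, if lam k = 0 then c k ^ 2 else 0) ≤
      (sphereIntegral (volume : Measure E) f r) ^ 2 / σ := by
    have h1 : (∑ k, if lam k = 0 then c k ^ 2 else 0) =
        (sphereIntegral (volume : Measure E) f r) ^ 2 * ∑ k, d k ^ 2 := by
      rw [Finset.mul_sum]
      refine Finset.sum_congr rfl fun k _ => ?_
      simp only [hd]
      split_ifs with hk
      · rw [hck k hk]; ring
      · simp
    rw [h1, div_eq_mul_one_div]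
    exact mul_le_mul_of_nonneg_left hsZ (sq_nonneg _)
  -- ### (7) assemble
  have hgap' : Λ * ((∑ k, c k ^ 2) - ∑ k, if lam k = 0 then c k ^ 2 else 0) ≤
      ∑ k, lam k * c k ^ 2 := by
    rw [← Finset.sum_sub_distrib, Finset.mul_sum]
    refine Finset.sum_le_sum fun k _ => ?_
    rcases hgap k with hk | hk
    · simp [hk]
    · have hne : ¬ (lam k = 0) ∨ lam k = 0 := em' _
      by_cases h0 : lam k = 0
      · simp [h0]
      · simp only [h0, if_false, sub_zero]
        exact mul_le_mul_of_nonneg_right hk (sq_nonneg _)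
  have hgoal : Λ * (sphereIntegral (volume : Measure E) (fun x => f x ^ 2) r -
      sphereIntegral (volume : Measure E) (fun x => g x ^ 2) r -
      (sphereIntegral (volume : Measure E) f r) ^ 2 / σ) ≤ sphDirichlet b f f r := by
    rw [hsplit, hcross, hdiag, mul_zero, add_zero, ← hpyth]
    calc Λ * (∑ k, c k ^ 2 - (sphereIntegral (volume : Measure E) f r) ^ 2 / σ)
        ≤ Λ * ((∑ k, c k ^ 2) - ∑ k, if lam k = 0 then c k ^ 2 else 0) :=
          mul_le_mul_of_nonneg_left (by linarith [hZ]) hΛ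
      _ ≤ ∑ k, lam k * c k ^ 2 := hgap'
      _ ≤ ∑ k, lam k * c k ^ 2 + sphDirichlet b g g r := le_add_of_nonneg_right hpos
  exact hgoal

end Sphere

end Literature.Analysis.Calculus
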